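import Summits.CriticalPhenomena.PercolationContinuityZ3.Theorems.PercHyperscalingGluingFreeBoxShatteringStubUniqCeiling
import Summits.CriticalPhenomena.PercolationContinuityZ3.Theorems.PercNonProliferationFreeBoxSparseTorusParking
import Summits.CriticalPhenomena.PercolationContinuityZ3.Theorems.FreeBoxSparse.Negative.CentredForms

/-!
# Uniqueness is the engine: `FreeBoxShattering ↔ TwoDensePiecesRare` (stub `stub_uniquenessGluing`,
# crux `PercHyperscalingGluing.FreeBoxShattering`, stmt-CriticalPhenomena-4644, line `birth`)

**Theorem (`stub_uniquenessGluing`).** For critical bond percolation on `ℤ³`,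
`F_r := |Λ_r|⁻¹ Σ_{x∈Λ_r} P_{p_c}(0 ↔ x inside Λ_r) → 0` (the crux; equivalently the twin cruxes
`PercNonProliferation.FreeBoxSparse`, stmt-4445, and `PercHollowCells.FreeBoxShattering`, stmt-5836)
**iff** `TwoDensePiecesRare`: for every `δ > 0`,
`P_{p_c}(∃ x, x' ∈ Λ_N not joined inside Λ_N, both with in-box clusters of ≥ δ|Λ_N| vertices) → 0`.
At `p_c(ℤ³)`, macroscopic in-box clusters are asymptotically ABSENT iff asymptotically UNIQUE.

* `→`: two dense pieces are one dense piece; `P(dense piece) → 0` under the crux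
  (`TorusParking.freeBoxSparse_iff_noFreeGiant`, `Negative/CentredForms`).
* `←` (`UniquenessGluing.crux_of_twoDense_le`, quantitative: it suffices that the two-pieces
  probability is eventually `≤ c₀/16`, `c₀` the constant of the uniqueness ceiling): `¬ crux` gives
  `F_r ≥ ε` infinitely often, hence (M: first moment at the centre, `StubBoost.half_le_real_dense`)
  a `(ε/2)|Λ_r|`-piece with probability `≥ ε/2`, hence (B: boosting by `(2m+1)³` independent
  sub-boxes, `StubBoost.real_compl_dense_bigBox_le`) some density `δ` carried with probability
  `≥ 1 - c₀/16` at infinitely many scales `R`; with the two-pieces probability of `Λ_{2R+1}` at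
  threshold `(δ/27)|Λ_{2R+1}| ≤ δ|Λ_R|` also `≤ c₀/16`, `4a + 3b ≤ 7c₀/16 < c₀` contradicts the
  uniqueness ceiling `stub_uniqCeiling` (DST/LSS renormalisation + Barsky–Grimmett–Newman).
Criticality enters only through BGN: at `p = 1` the right side holds and the crux fails; off
criticality the right side holds on both sides of `p_c` (no giants below; supercritical box-giant
uniqueness above), so `¬ crux` says exactly that `p_c` is a parameter at which two macroscopic
in-box clusters coexist with non-vanishing probability along a subsequence of scales.

## References
* D. J. Barsky, G. R. Grimmett, C. M. Newman, PTRF 90 (1991), Thm. 1.1; G. Grimmett, *Percolation*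
  (1999), Thm. (7.35), (7.65); H. Duminil-Copin, V. Sidoravicius, V. Tassion, CPAM 69 (2016), §2.2;
  T. M. Liggett, R. H. Schonmann, A. M. Stacey, AoP 25 (1997); T. Hutchcroft, arXiv:2202.07634, p. 5
  (the unsourced "folklore" sentence this crux formalises); P. Easo, T. Hutchcroft, arXiv:2112.12778,
  Rem. 1.4 (critical torus giants: open).
-/

noncomputable section
namespace Summit.CriticalPhenomena.PercolationContinuityZ3.Theorems.FreeBoxShattering

open MeasureTheory Filter
open Literature.Probability.Percolation Literature.Probability.LatticeModels
open scoped Topology Classical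
open Summit.CriticalPhenomena.PercolationContinuityZ3.Theses.PercHyperscalingGluing (FreeBoxShattering)
open Summit.CriticalPhenomena.PercolationContinuityZ3.Theorems.FreeBoxSparse.StubBoost
  (half_le_real_dense real_compl_dense_bigBox_le measurableSet_dense card_bigBox)
open Summit.CriticalPhenomena.PercolationContinuityZ3.Theorems.FreeBoxSparse.Negative
  (freeBoxSparse_iff_hyperscalingGluing_freeBoxShattering hyperscalingGluing_iff_hollowCells_freeBoxShattering)
open Summit.CriticalPhenomena.PercolationContinuityZ3.Theorems.FreeBoxSparse.TorusParking
  (freeBoxSparse_iff_noFreeGiant)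

namespace UniquenessGluing

local notation3 "μc" => bondPercolation (zdGraph 3) (criticalProbI 3)
local notation3 "piece⟦" Λ ", " ω ", " x "⟧" =>
  ((Finset.filter (fun v => (ω : BondConfig (Site 3)) ∈
    openConnIn (↑(Λ : Finset (Site 3)) : Set (Site 3)) x v) Λ).card : ℝ)
local notation3 "dense⟦" Λ ", " θ "⟧" =>
  {ω : BondConfig (Site 3) | ∃ x ∈ (Λ : Finset (Site 3)), (θ : ℝ) ≤ piece⟦Λ, ω, x⟧}
local notation3 "twoDense⟦" Λ ", " θ "⟧" =>
  {ω : BondConfig (Site 3) | ∃ x ∈ (Λ : Finset (Site 3)), ∃ x' ∈ Λ,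
    ω ∉ openConnIn (↑Λ : Set (Site 3)) x x' ∧ (θ : ℝ) ≤ piece⟦Λ, ω, x⟧ ∧ (θ : ℝ) ≤ piece⟦Λ, ω, x'⟧}
/-- `F_r := |Λ_r|⁻¹ Σ_{x∈Λ_r} P_{p_c}(0 ↔ x inside Λ_r)` — the crux's sequence. -/
local notation3 "F⟦" r "⟧" => (((box 3 r).card : ℝ)⁻¹ *
  ∑ x ∈ box 3 r, (bondPercolation (zdGraph 3) (criticalProbI 3)).real (openConnIn ↑(box 3 r) 0 x))

/-- The crux is literally `F_r → 0`. [folklore] -/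
theorem crux_iff : FreeBoxShattering ↔ Tendsto (fun r : ℕ => F⟦r⟧) atTop (𝓝 0) := Iff.rfl

/-- **(M) First moment at the centre.** If `F_r ≥ 2c` (`c ≥ 0`) then with probability `≥ c` some
site of `Λ_r` has a free piece with `≥ c|Λ_r|` vertices (landed `StubBoost.half_le_real_dense` with
the dummy-rooted events `{0 ↔ y in Λ_r}`). [folklore] -/
theorem le_real_dense_of_le (c : ℝ) (hc : 0 ≤ c) (r : ℕ) (h : 2 * c ≤ F⟦r⟧) :
    c ≤ (μc).real dense⟦box 3 r, c * ((box 3 r).card : ℝ)⟧ := by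
  have hcard : (0 : ℝ) < (box 3 r).card := by exact_mod_cast Finset.card_pos.2 (box_nonempty 3 r)
  have h1 : 2 * c * ((box 3 r).card : ℝ) ≤
      ∑ y ∈ box 3 r, (μc).real (openConnIn (↑(box 3 r) : Set (Site 3)) 0 y) := by
    calc 2 * c * ((box 3 r).card : ℝ)
        ≤ ((box 3 r).card : ℝ)⁻¹ * (∑ y ∈ box 3 r,
            (μc).real (openConnIn (↑(box 3 r) : Set (Site 3)) 0 y)) * ((box 3 r).card : ℝ) :=
          mul_le_mul_of_nonneg_right h hcard.le
      _ = ∑ y ∈ box 3 r, (μc).real (openConnIn (↑(box 3 r) : Set (Site 3)) 0 y) := by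
          field_simp
  have h2 : 2 * c * ((box 3 r).card : ℝ) ^ 2 ≤
      ∑ _u ∈ box 3 r, ∑ y ∈ box 3 r, (μc).real (openConnIn (↑(box 3 r) : Set (Site 3)) 0 y) := by
    rw [Finset.sum_const, nsmul_eq_mul]
    calc 2 * c * ((box 3 r).card : ℝ) ^ 2
        = ((box 3 r).card : ℝ) * (2 * c * ((box 3 r).card : ℝ)) := by ring
      _ ≤ ((box 3 r).card : ℝ) *
          ∑ y ∈ box 3 r, (μc).real (openConnIn (↑(box 3 r) : Set (Site 3)) 0 y) :=
          mul_le_mul_of_nonneg_left h1 hcard.le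
  have hA := half_le_real_dense μc (box_nonempty 3 r)
    (fun _ y => openConnIn (↑(box 3 r) : Set (Site 3)) 0 y)
    (fun _ _ y _ => DCT16.measurableSet_openConnIn (box 3 r) 0 y) (by positivity : (0 : ℝ) ≤ 2 * c) h2
  rw [show 2 * c / 2 = c by ring] at hA
  refine hA.trans (measureReal_mono ?_)
  rintro ω ⟨_u, _hu, hω⟩
  exact ⟨0, zero_mem_box 3 r, hω⟩

/-- **(B) Boosting by independent sub-boxes** (landed `StubBoost.real_compl_dense_bigBox_le`): if
`Λ_r` has a `δ|Λ_r|`-piece with probability `≥ c > 0` infinitely often, then for every `η > 0` there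
is `m` with `Λ_R`, `R = (2m+1)r + m`, carrying a `(δ/(2m+1)³)|Λ_R|`-piece with probability `≥ 1 - η`,
infinitely often. [folklore] -/
theorem boost {δ c : ℝ} (hc : 0 < c)
    (h : ∃ᶠ r : ℕ in atTop, c ≤ (μc).real dense⟦box 3 r, δ * ((box 3 r).card : ℝ)⟧)
    {η : ℝ} (hη : 0 < η) : ∃ m : ℕ, ∃ᶠ R : ℕ in atTop,
      1 - η ≤ (μc).real dense⟦box 3 R, δ / (2 * (m : ℝ) + 1) ^ 3 * ((box 3 R).card : ℝ)⟧ := by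
  obtain ⟨m, hm⟩ : ∃ m : ℕ, (max (1 - c) 0) ^ m < η :=
    exists_pow_lt_of_lt_one hη (max_lt (by linarith) one_pos)
  have hmcard : m ≤ (box 3 m).card := by
    rw [card_box]; exact (show m ≤ 2 * m + 1 by omega).trans (Nat.le_self_pow three_ne_zero _)
  have hpow : (max (1 - c) 0) ^ (box 3 m).card ≤ η :=
    (pow_le_pow_of_le_one (le_max_right _ _) (max_le (by linarith) zero_le_one) hmcard).trans hm.le
  refine ⟨m, ?_⟩
  rw [Filter.frequently_atTop] at h ⊢
  intro a
  obtain ⟨r, hra, hr⟩ := h a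
  refine ⟨(2 * m + 1) * r + m, hra.trans ?_, ?_⟩
  · calc r = 1 * r + 0 := by ring
      _ ≤ (2 * m + 1) * r + m := by gcongr <;> omega
  · have hθ : (μc).real (dense⟦box 3 r, δ * ((box 3 r).card : ℝ)⟧)ᶜ ≤ max (1 - c) 0 := by
      rw [probReal_compl_eq_one_sub (measurableSet_dense _ _)]
      exact le_trans (by linarith) (le_max_left _ _)
    have hF := (real_compl_dense_bigBox_le (criticalProbI 3) r m (δ * ((box 3 r).card : ℝ)) hθ).trans
      hpow
    rw [probReal_compl_eq_one_sub (measurableSet_dense _ _)] at hF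
    have hthr : δ / (2 * (m : ℝ) + 1) ^ 3 * ((box 3 ((2 * m + 1) * r + m)).card : ℝ) =
        δ * ((box 3 r).card : ℝ) := by
      rw [card_bigBox]; field_simp
    rw [hthr]
    linarith

/-- **(M)+(B): `¬ crux` forces high-probability giants infinitely often at every level.**
[folklore] -/
theorem frequently_dense_of_not_crux (hS : ¬ FreeBoxShattering) {η : ℝ} (hη : 0 < η) :
    ∃ δ : ℝ, 0 < δ ∧ ∃ᶠ R : ℕ in atTop, 1 - η ≤ (μc).real dense⟦box 3 R, δ * ((box 3 R).card : ℝ)⟧ := by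
  rw [crux_iff] at hS
  -- a nonnegative sequence not tending to `0` is `≥ ε` infinitely often, for some `ε > 0`
  -- (cf. `Literature.Barriers.CriticalPhenomena.LongRangeIsing.exists_frequently_le_of_not_tendsto`)
  obtain ⟨ε, hε, hfreq⟩ : ∃ ε : ℝ, 0 < ε ∧ ∃ᶠ r : ℕ in atTop, ε ≤ F⟦r⟧ := by
    by_contra hcon
    apply hS
    rw [tendsto_order]
    refine ⟨fun a ha => Eventually.of_forall fun r => ha.trans_le (mul_nonneg
      (inv_nonneg.2 (Nat.cast_nonneg _)) (Finset.sum_nonneg fun _ _ => measureReal_nonneg)),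
      fun a ha => ?_⟩
    by_contra hev
    exact hcon ⟨a, ha, (Filter.not_eventually.1 hev).mono fun n hn => not_lt.1 hn⟩
  have h1 : ∃ᶠ r : ℕ in atTop, ε / 2 ≤ (μc).real dense⟦box 3 r, ε / 2 * ((box 3 r).card : ℝ)⟧ :=
    hfreq.mono fun r hr => le_real_dense_of_le (ε / 2) (half_pos hε).le r (by linarith)
  obtain ⟨m, h2⟩ := boost (half_pos hε) h1 hη
  exact ⟨ε / 2 / (2 * (m : ℝ) + 1) ^ 3, by positivity, h2⟩

/-- Under the crux, giants of every density have vanishing probability (landed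
`TorusParking.freeBoxSparse_iff_noFreeGiant` + `Negative/CentredForms`). [folklore] -/
theorem tendsto_dense_of_crux (hS : FreeBoxShattering) {δ : ℝ} (hδ : 0 < δ) :
    Tendsto (fun N : ℕ => (μc).real dense⟦box 3 N, δ * ((box 3 N).card : ℝ)⟧) atTop (𝓝 0) :=
  freeBoxSparse_iff_noFreeGiant.1 (freeBoxSparse_iff_hyperscalingGluing_freeBoxShattering.2 hS) δ hδ

/-- **Uniqueness is the engine, quantitative form.** With `c₀` the constant of the uniqueness
ceiling (`stub_uniqCeiling`): if for every density `δ > 0`, eventually in `N`,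
`P_{p_c}(Λ_N has two disjoint δ|Λ_N|-pieces) ≤ c₀/16`, then the crux holds (`¬ crux ⇒` (M)+(B) a
density carried with probability `≥ 1 - c₀/16` infinitely often; at a large such `R`,
`4a + 3b ≤ 7c₀/16 < c₀`). [folklore] -/
theorem crux_of_twoDense_le : ∃ c : ℝ, 0 < c ∧ ((∀ δ : ℝ, 0 < δ → ∀ᶠ N : ℕ in atTop,
      (μc).real twoDense⟦box 3 N, δ * ((box 3 N).card : ℝ)⟧ ≤ c) → FreeBoxShattering) := by
  obtain ⟨c₀, hc₀, hceil⟩ := stub_uniqCeiling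
  refine ⟨c₀ / 16, by positivity, fun hU => ?_⟩
  by_contra hS
  obtain ⟨δ, hδ, hfreq⟩ := frequently_dense_of_not_crux hS (by positivity : (0 : ℝ) < c₀ / 16)
  have h2R : Tendsto (fun R : ℕ => 2 * R + 1) atTop atTop :=
    tendsto_atTop_mono (fun R => by show R ≤ 2 * R + 1; omega) tendsto_id
  obtain ⟨R, hgoodR, hsmR⟩ := (hfreq.and_eventually (h2R.eventually (hU (δ / 27) (by positivity)))).exists
  have hθ : δ / 27 * ((box 3 (2 * R + 1)).card : ℝ) ≤ δ * ((box 3 R).card : ℝ) := by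
    rw [card_box, card_box]
    push_cast
    have h1 : (2 * (2 * (R : ℝ) + 1) + 1) ^ 3 ≤ (3 * (2 * (R : ℝ) + 1)) ^ 3 := by
      gcongr; linarith
    have h2 : (3 * (2 * (R : ℝ) + 1)) ^ 3 = 27 * (2 * (R : ℝ) + 1) ^ 3 := by ring
    rw [h2] at h1
    have h3 : 0 ≤ δ * (27 * (2 * (R : ℝ) + 1) ^ 3 - (2 * (2 * (R : ℝ) + 1) + 1) ^ 3) :=
      mul_nonneg hδ.le (by linarith)
    nlinarith
  have ha : (μc).real (dense⟦box 3 R, δ * ((box 3 R).card : ℝ)⟧)ᶜ ≤ c₀ / 16 := by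
    rw [probReal_compl_eq_one_sub (measurableSet_dense _ _)]
    linarith
  have hc := hceil R (δ * ((box 3 R).card : ℝ)) (δ / 27 * ((box 3 (2 * R + 1)).card : ℝ)) hθ
  linarith

end UniquenessGluing

/-- **stub_uniquenessGluing — UNIQUENESS IS THE ENGINE** (registered stub of crux
stmt-CriticalPhenomena-4644): the crux `FreeBoxShattering` (by name) holds iff for every `δ > 0`
the `P_{p_c}`-probability that `Λ_N` contains two vertices not joined inside `Λ_N` whose in-box
clusters both have `≥ δ|Λ_N|` vertices tends to `0` (`TwoDensePiecesRare`). `→`: two dense pieces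
are one dense piece, whose probability vanishes under the crux. `←`: `crux_of_twoDense_le` (the
uniqueness ceiling `stub_uniqCeiling` + first moment + boosting). At `p_c(ℤ³)` in-box giants are
asymptotically ABSENT iff asymptotically UNIQUE; criticality enters through Barsky–Grimmett–Newman
(at `p = 1` the right side holds and the left fails). [folklore] -/
theorem stub_uniquenessGluing :
    Summit.CriticalPhenomena.PercolationContinuityZ3.Theses.PercHyperscalingGluing.FreeBoxShattering ↔
      ∀ δ : ℝ, 0 < δ → Tendsto (fun N : ℕ => (bondPercolation (zdGraph 3) (criticalProbI 3)).real
        {ω | ∃ x ∈ box 3 N, ∃ x' ∈ box 3 N, ω ∉ openConnIn ↑(box 3 N) x x' ∧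
          δ * ((box 3 N).card : ℝ) ≤
            (((box 3 N).filter fun v => ω ∈ openConnIn ↑(box 3 N) x v).card : ℝ) ∧
          δ * ((box 3 N).card : ℝ) ≤
            (((box 3 N).filter fun v => ω ∈ openConnIn ↑(box 3 N) x' v).card : ℝ)})
        atTop (𝓝 0) := by
  constructor
  · intro hS δ hδ
    refine squeeze_zero (fun N => measureReal_nonneg) (fun N => measureReal_mono ?_)
      (UniquenessGluing.tendsto_dense_of_crux hS hδ)
    rintro ω ⟨x, hx, _, _, _, h1, _⟩
    exact ⟨x, hx, h1⟩
  · intro hU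
    obtain ⟨c, hc, h⟩ := UniquenessGluing.crux_of_twoDense_le
    exact h fun δ hδ => ((tendsto_order.1 (hU δ hδ)).2 c hc).mono fun N hN => hN.le

/-- The same equivalence for the twin crux `PercNonProliferation.FreeBoxSparse` (stmt-4445).
[folklore] -/
theorem freeBoxSparse_iff_twoDensePiecesRare :
    Summit.CriticalPhenomena.PercolationContinuityZ3.Theses.PercNonProliferation.FreeBoxSparse ↔
      ∀ δ : ℝ, 0 < δ → Tendsto (fun N : ℕ => (bondPercolation (zdGraph 3) (criticalProbI 3)).real
        {ω | ∃ x ∈ box 3 N, ∃ x' ∈ box 3 N, ω ∉ openConnIn ↑(box 3 N) x x' ∧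
          δ * ((box 3 N).card : ℝ) ≤
            (((box 3 N).filter fun v => ω ∈ openConnIn ↑(box 3 N) x v).card : ℝ) ∧
          δ * ((box 3 N).card : ℝ) ≤
            (((box 3 N).filter fun v => ω ∈ openConnIn ↑(box 3 N) x' v).card : ℝ)})
        atTop (𝓝 0) :=
  freeBoxSparse_iff_hyperscalingGluing_freeBoxShattering.trans stub_uniquenessGluing

/-- The same equivalence for the twin crux `PercHollowCells.FreeBoxShattering` (stmt-5836).
[folklore] -/
theorem hollowCellsFreeBoxShattering_iff_twoDensePiecesRare :
    Summit.CriticalPhenomena.PercolationContinuityZ3.Theses.PercHollowCells.FreeBoxShattering ↔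
      ∀ δ : ℝ, 0 < δ → Tendsto (fun N : ℕ => (bondPercolation (zdGraph 3) (criticalProbI 3)).real
        {ω | ∃ x ∈ box 3 N, ∃ x' ∈ box 3 N, ω ∉ openConnIn ↑(box 3 N) x x' ∧
          δ * ((box 3 N).card : ℝ) ≤
            (((box 3 N).filter fun v => ω ∈ openConnIn ↑(box 3 N) x v).card : ℝ) ∧
          δ * ((box 3 N).card : ℝ) ≤
            (((box 3 N).filter fun v => ω ∈ openConnIn ↑(box 3 N) x' v).card : ℝ)})
        atTop (𝓝 0) :=
  hyperscalingGluing_iff_hollowCells_freeBoxShattering.symm.trans stub_uniquenessGluing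

end Summit.CriticalPhenomena.PercolationContinuityZ3.Theorems.FreeBoxShattering

end
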